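import Summits.MatrixMultiplication.MatrixMultiplication.Theorems.LieRankBeatsCubes.Negative.BorelSubgroups

/-!
# `LieRankBeatsCubes` (crux stmt-MatrixMultiplication-14057), negative lane: the alternating LDU functional
# annihilates the level-one test space of `GL_2(𝔽_p)`

Negative-lane support file of the crux disprover (cdisprove seat
`refuter-cdisprove-stmt-MatrixMultiplication-14057-0`); everything `sorry`-free, no Theses statement is
asserted.

`Λ_c(F) = Σ_{β,γ} [F(g₁₁) − F(g₁c) − F(g_c1) + F(g_cc)]`, `g_{ad} = [1 0; γ 1]·diag(a,d)·[1 β; 0 1]`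
(`Λ`, `Λ_apply`), is a linear form on `ℂ^{GL_2(𝔽_p)}` which VANISHES on every level-one function
(`Λ_fourierFn_eq_zero`): a level-one test `Σ_{rk M ≤ 1} c_M ψ(tr(M g))` is a combination of functions of ONE
matrix–vector product `g·u` (`exists_vecMulVec_of_rank_le_one`, `trace_vecMulVec_mul`), and on each block
`U⁻ diag(a,d) U⁺` the fibres of `g ↦ g·u` split as `K(d) + A(a)` (`blockSum_eq`), which the alternating signs
cancel (`Λ_apply_mulVec`).  The companion file `BorelConfiguration.lean` evaluates `Λ_c` on separating functions.
-/

noncomputable section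

open scoped BigOperators

namespace Summit.MatrixMultiplication.MatrixMultiplication.Theorems.LieRankBeatsCubes.Negative

open Summit.MatrixMultiplication.MatrixMultiplication.Theorems.LieRankDesigns.Negative

variable {p : ℕ} [Fact p.Prime]

omit [Fact (Nat.Prime p)] in
/-- Evaluation at `g`, as a linear form on `ℂ^{GL_2(𝔽_p)}`. -/
def ev (g : GLm p 2) : (GLm p 2 → ℂ) →ₗ[ℂ] ℂ := LinearMap.proj (R := ℂ) (φ := fun _ : GLm p 2 => ℂ) g

omit [Fact (Nat.Prime p)] in
/-- `ev g F = F g`. -/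
@[simp] theorem ev_apply (g : GLm p 2) (F : GLm p 2 → ℂ) : ev g F = F g := rfl

/-- The alternating LDU functional (a linear form on `ℂ^{GL_2(𝔽_p)}`):
`Λ_c(F) = Σ_{β,γ} [F(g₁₁) − F(g₁c) − F(g_c1) + F(g_cc)]`, `g_{ad} = [1 0; γ 1]·diag(a,d)·[1 β; 0 1]`. -/
def Λ (c : (ZMod p)ˣ) : (GLm p 2 → ℂ) →ₗ[ℂ] ℂ :=
  ∑ β : ZMod p, ∑ γ : ZMod p,
    (ev (uMinus γ * torU 1 1 * uPlus β) - ev (uMinus γ * torU 1 c * uPlus β)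
      - ev (uMinus γ * torU c 1 * uPlus β) + ev (uMinus γ * torU c c * uPlus β))

/-- `Λ_c` evaluated: the alternating double sum over the four LDU blocks. -/
theorem Λ_apply (c : (ZMod p)ˣ) (F : GLm p 2 → ℂ) :
    Λ c F = ∑ β : ZMod p, ∑ γ : ZMod p,
      (F (uMinus γ * torU 1 1 * uPlus β) - F (uMinus γ * torU 1 c * uPlus β)
        - F (uMinus γ * torU c 1 * uPlus β) + F (uMinus γ * torU c c * uPlus β)) := by
  simp only [Λ, LinearMap.coe_sum, Finset.sum_apply, LinearMap.sub_apply, LinearMap.add_apply, ev_apply]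

/-- A Fourier function is the linear combination `Σ_M c_M • ψ(tr(M ·))`. -/
theorem fourierFn_eq_sum_smul (c' : Mat p 2 → ℂ) :
    (fourierFn c' : GLm p 2 → ℂ) =
      ∑ M : Mat p 2, c' M • fun g : GLm p 2 => (ZMod.stdAddChar (Matrix.trace (M * (g : Mat p 2))) : ℂ) := by
  funext g
  simp [fourierFn, Finset.sum_apply]

/-- The two coordinates of `g·u` for the LDU product `g = [a, aβ; γa, γaβ + d]` and `u = (u₀, u₁)`. -/
theorem ldu_mulVec (γ : ZMod p) (a d : (ZMod p)ˣ) (β u₀ u₁ : ZMod p) :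
    ((uMinus γ * torU a d * uPlus β : GLm p 2) : Mat p 2) 0 0 * u₀ +
        ((uMinus γ * torU a d * uPlus β : GLm p 2) : Mat p 2) 0 1 * u₁ = a * (u₀ + β * u₁) ∧
    ((uMinus γ * torU a d * uPlus β : GLm p 2) : Mat p 2) 1 0 * u₀ +
        ((uMinus γ * torU a d * uPlus β : GLm p 2) : Mat p 2) 1 1 * u₁ =
      γ * (a * (u₀ + β * u₁)) + d * u₁ := by
  rw [coe_ldu]
  simp only [Matrix.of_apply, Matrix.cons_val', Matrix.cons_val_zero, Matrix.cons_val_one,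
    Matrix.cons_val_fin_one]
  constructor <;> ring

/-- The `(a, d)`-block sum of a function of `g·u`:
`S(a,d) = Σ_{β,γ} Φ(a(u₀ + βu₁), γa(u₀ + βu₁) + d u₁)`. -/
def blockSum (Φ : ZMod p → ZMod p → ℂ) (u₀ u₁ : ZMod p) (a d : (ZMod p)ˣ) : ℂ :=
  ∑ β : ZMod p, ∑ γ : ZMod p, Φ (a * (u₀ + β * u₁)) (γ * (a * (u₀ + β * u₁)) + d * u₁)

/-- **Fiber computation.**  For `u₁ ≠ 0` the block sum splits as `S(a, d) = K(d) + A(a)` with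
`K(d) = p·Φ(0, d u₁)` (the line `u₀ + βu₁ = 0`) and `A(a) = Σ_{s ≠ 0} Σ_t Φ(a s, t)` (all other lines,
on each of which `γ ↦ γ a s + d u₁` is a bijection). -/
theorem blockSum_eq (Φ : ZMod p → ZMod p → ℂ) (u₀ : ZMod p) {u₁ : ZMod p} (hu₁ : u₁ ≠ 0)
    (a d : (ZMod p)ˣ) :
    blockSum Φ u₀ u₁ a d =
      (∑ _γ : ZMod p, Φ 0 (d * u₁)) +
        ∑ s ∈ (Finset.univ : Finset (ZMod p)).erase 0, ∑ t : ZMod p, Φ (a * s) t := by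
  classical
  unfold blockSum
  -- reindex β ↦ s = u₀ + β u₁
  set F : ZMod p → ℂ := fun s => ∑ γ : ZMod p, Φ (a * s) (γ * (a * s) + d * u₁) with hF
  have h1 : (∑ β : ZMod p, ∑ γ : ZMod p, Φ (a * (u₀ + β * u₁)) (γ * (a * (u₀ + β * u₁)) + d * u₁)) =
      ∑ s : ZMod p, F s := by
    let e : ZMod p ≃ ZMod p := (Equiv.mulRight₀ u₁ hu₁).trans (Equiv.addLeft u₀)
    exact Equiv.sum_comp e F
  rw [h1, ← Finset.add_sum_erase _ _ (Finset.mem_univ (0 : ZMod p))]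
  congr 1
  · simp [hF]
  · refine Finset.sum_congr rfl fun s hs => ?_
    have hs0 : s ≠ 0 := Finset.ne_of_mem_erase hs
    simp only [hF]
    let e : ZMod p ≃ ZMod p := (Equiv.mulRight₀ (a * s) (mul_ne_zero a.ne_zero hs0)).trans
      (Equiv.addRight (d * u₁))
    exact Equiv.sum_comp e (Φ (a * s))

/-- **FIBER LEMMA.**  The alternating functional kills every function of a single matrix–vector product
`g·u` — i.e. every generator of the level-one test space: for all `u = (u₀, u₁)` and `Φ`,
`Λ_c (g ↦ Φ(g·u)) = 0`. -/
theorem Λ_apply_mulVec (c : (ZMod p)ˣ) (Φ : ZMod p → ZMod p → ℂ) (u₀ u₁ : ZMod p) :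
    Λ c (fun g => Φ ((g : Mat p 2) 0 0 * u₀ + (g : Mat p 2) 0 1 * u₁)
      ((g : Mat p 2) 1 0 * u₀ + (g : Mat p 2) 1 1 * u₁)) = 0 := by
  classical
  rw [Λ_apply]
  have hrw : ∀ (a d : (ZMod p)ˣ) (β γ : ZMod p),
      Φ (((uMinus γ * torU a d * uPlus β : GLm p 2) : Mat p 2) 0 0 * u₀ +
          ((uMinus γ * torU a d * uPlus β : GLm p 2) : Mat p 2) 0 1 * u₁)
        (((uMinus γ * torU a d * uPlus β : GLm p 2) : Mat p 2) 1 0 * u₀ +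
          ((uMinus γ * torU a d * uPlus β : GLm p 2) : Mat p 2) 1 1 * u₁) =
      Φ (a * (u₀ + β * u₁)) (γ * (a * (u₀ + β * u₁)) + d * u₁) := by
    intro a d β γ
    obtain ⟨h1, h2⟩ := ldu_mulVec γ a d β u₀ u₁
    rw [h1, h2]
  simp only [hrw]
  rw [show (∑ β : ZMod p, ∑ γ : ZMod p,
      (Φ (((1 : (ZMod p)ˣ) : ZMod p) * (u₀ + β * u₁)) (γ * (((1 : (ZMod p)ˣ) : ZMod p) * (u₀ + β * u₁)) + ((1 : (ZMod p)ˣ) : ZMod p) * u₁)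
        - Φ (((1 : (ZMod p)ˣ) : ZMod p) * (u₀ + β * u₁)) (γ * (((1 : (ZMod p)ˣ) : ZMod p) * (u₀ + β * u₁)) + (c : ZMod p) * u₁)
        - Φ ((c : ZMod p) * (u₀ + β * u₁)) (γ * ((c : ZMod p) * (u₀ + β * u₁)) + ((1 : (ZMod p)ˣ) : ZMod p) * u₁)
        + Φ ((c : ZMod p) * (u₀ + β * u₁)) (γ * ((c : ZMod p) * (u₀ + β * u₁)) + (c : ZMod p) * u₁))) =
      blockSum Φ u₀ u₁ 1 1 - blockSum Φ u₀ u₁ 1 c - blockSum Φ u₀ u₁ c 1 + blockSum Φ u₀ u₁ c c by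
    simp only [blockSum, ← Finset.sum_sub_distrib, ← Finset.sum_add_distrib]]
  by_cases hu₁ : u₁ = 0
  · subst hu₁
    simp [blockSum]
  · rw [blockSum_eq Φ u₀ hu₁, blockSum_eq Φ u₀ hu₁, blockSum_eq Φ u₀ hu₁, blockSum_eq Φ u₀ hu₁]
    ring

/-- A matrix of rank `≤ 1` over a field is an outer product `u vᵀ` (converse of Mathlib's
`Matrix.rank_vecMulVec_le`; same proof as the tree's
`Literature.Computability.AlgebraicComplexity.exists_vecMulVec_of_rank_le_one`, copied to keep the
import closure light). [folklore] -/
theorem exists_vecMulVec_of_rank_le_one {K : Type*} [Field K] {ι κ : Type*} [Fintype κ] [DecidableEq κ]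
    (M : Matrix ι κ K) (h : M.rank ≤ 1) : ∃ (u : ι → K) (v : κ → K), M = Matrix.vecMulVec u v := by
  obtain ⟨w, hw⟩ := finrank_le_one_iff.mp h
  have hcol : ∀ j, ∃ a : K, ∀ i, a * (w : ι → K) i = M i j := fun j => by
    have hj : M.col j ∈ LinearMap.range M.mulVecLin :=
      ⟨Pi.single j 1, by rw [Matrix.mulVecLin_apply, Matrix.mulVec_single_one]⟩
    obtain ⟨a, ha⟩ := hw ⟨M.col j, hj⟩
    refine ⟨a, fun i => ?_⟩
    have := congrArg (fun x : LinearMap.range M.mulVecLin => (x : ι → K) i) ha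
    simpa using this
  choose a ha using hcol
  exact ⟨w, a, Matrix.ext fun i j => by rw [Matrix.vecMulVec_apply, ← ha j i, mul_comm]⟩

/-- Trace pairing with an outer product is a function of `g·u`:
`tr(u vᵀ · g) = v₀ (g u)₀ + v₁ (g u)₁`. [folklore] -/
theorem trace_vecMulVec_mul (u v : Fin 2 → ZMod p) (g : Mat p 2) :
    Matrix.trace (Matrix.vecMulVec u v * g) =
      v 0 * (g 0 0 * u 0 + g 0 1 * u 1) + v 1 * (g 1 0 * u 0 + g 1 1 * u 1) := by
  rw [Matrix.trace_fin_two]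
  simp only [Matrix.mul_apply, Fin.sum_univ_two, Matrix.vecMulVec_apply]
  ring

/-- **`Λ` vanishes on the whole level-one test space `F_1`.** -/
theorem Λ_fourierFn_eq_zero (c : (ZMod p)ˣ) {c' : Mat p 2 → ℂ} (hc' : RankSupp 1 c') :
    Λ c (fourierFn c') = 0 := by
  classical
  rw [fourierFn_eq_sum_smul, map_sum]
  refine Finset.sum_eq_zero fun M _ => ?_
  rw [map_smul, smul_eq_mul]
  by_cases hM : 1 < M.rank
  · rw [hc' M hM, zero_mul]
  · push Not at hM
    obtain ⟨u, v, rfl⟩ := exists_vecMulVec_of_rank_le_one M hM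
    have := Λ_apply_mulVec c
      (fun s t => (ZMod.stdAddChar (v 0 * s + v 1 * t) : ℂ)) (u 0) (u 1)
    simp only [trace_vecMulVec_mul]
    rw [this, mul_zero]

end Summit.MatrixMultiplication.MatrixMultiplication.Theorems.LieRankBeatsCubes.Negative

end
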